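import Summits.RiemannHypothesis.RiemannHypothesis.Theorems.PfPersistenceEdgeLawUniversal
import Summits.RiemannHypothesis.RiemannHypothesis.Theorems.PfPersistenceProfileDeriv
import HarnessLib

/-!
# The DINI edge law: the one-sided window slopes of the bottom are bounded by the virial at
# EVERY window — no differentiability of the bottom assumed (pub-rhpf, theory-1 gen 5; helper
# for crux `EvenSectorBarta.EvenOneSignedWindows`, item stmt-RiemannHypothesis-19953; RH-free)

**mechanism/rigidity campaign; no RH claims.**  Companion text:
`run/shared/lean/pub/pub-rhpf/pub-rhpf-theory-1/THEORY-EDGE-5.md` (request R2′ of THEORY-EDGE-4).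

`PfPersistenceEdgeLawUniversal` proves `a · ε'(a) = −V(u)` over the interface `WindowForm` AT THE
WINDOWS WHERE THE BOTTOM `ε = W.energy` IS DIFFERENTIABLE (a.e., by monotonicity).  This file
removes that hypothesis and keeps what survives at EVERY window `a > 0`: touching from above
(`energy_div_le_profile`: `ε(a/(1+η)) ≤ p_u(η)`, contact at `η = 0`) bounds the one-sided DINI
slopes of `ε` by the one-sided derivatives of the profile `p_u` of any ground state `u`:

* `WindowForm.lt_slope_energy_eventually_left`: a RIGHT profile derivative `V₊` (compression)
  gives, for every `s < −V₊/a`, `s < (ε(b) − ε(a))/(b − a)` for all windows `b ↑ a` close to `a`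
  — the lower-left Dini derivative satisfies `D₋ε(a) ≥ −V₊/a`;
* `WindowForm.slope_energy_lt_eventually_right`: a LEFT profile derivative `V₋` (expansion) gives,
  for every `s > −V₋/a`, `(ε(b) − ε(a))/(b − a) < s` for all `b ↓ a` close to `a` — the upper-right
  Dini derivative satisfies `D⁺ε(a) ≤ −V₋/a`;
* hence with one-sided derivatives of `ε` (`neg_div_le_of_hasDerivWithinAt_energy_Iio`,
  `le_neg_div_of_hasDerivWithinAt_energy_Ioi`): `ε'(a⁻) ≥ −V₊/a`, `ε'(a⁺) ≤ −V₋/a`; with a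
  two-sided profile derivative `V` (`WindowForm.dini_edge_law`): `D⁺ε(a) ≤ −V/a ≤ D₋ε(a)` — at a
  window carrying two ground states with virials `V ≠ V'` the bottom has a genuine CONCAVE CORNER
  (`not_differentiableAt_energy_of_ne`; right slopes `≤ −max/a < −min/a ≤` left slopes): the
  mode-switch channel (M) of the campaign, as a theorem-schema.
* ζ instances: `lt_slope_weilGroundEnergy_eventually` / `slope_weilGroundEnergy_lt_eventually`
  (every window, given the one-sided profile derivative) and — UNCONDITIONALLY AT EVERY WINDOW
  `0 < a < ½ log 2`, where the profile of every ground state is differentiable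
  (`hasDerivAt_weilDilationProfile_of_lt`, tree 8382bdf0aec2) —
  `dini_edge_law_weilGroundEnergy_of_lt`: `D⁺ε(a) ≤ −V(u)/a ≤ D₋ε(a)` for EVERY ground state `u`,
  `V(u) = weilSmallWindowVirial a u`; in particular two ground states of one small window with
  different virials force a corner of `weilGroundEnergy` there.

Nothing arithmetic enters (same interface as the universal law); the statements are the standard
one-sided Hellmann–Feynman inequalities at a level crossing.

References: T. Kato, *Perturbation Theory for Linear Operators* (1966) II §6.4 (one-sided
derivatives of eigenvalues at crossings), VII §4.6, VII §6.5; E. Bombieri, Rend. Mat. Acc. Lincei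
(9) 11 (2000) 183–233, §4 (the dilation).
-/

set_option linter.dupNamespace false

noncomputable section

open MeasureTheory Set Filter
open scoped Topology

namespace Summit.RiemannHypothesis.RiemannHypothesis.Theorems.PfPersistence

open Literature.NumberTheory.LFunctions

/-! ## §1 Window ↔ dilation parameter near a window `a > 0` -/

/-- `b ↦ a/b − 1` (the dilation parameter taking the window `a` to the window `b`) is continuous
at `b = a` with value `0` (`a ≠ 0`). [folklore] -/
theorem tendsto_window_param {a : ℝ} (ha : a ≠ 0) :
    Tendsto (fun b : ℝ ↦ a / b - 1) (𝓝 a) (𝓝 0) := by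
  have h1 : ContinuousAt (fun b : ℝ ↦ a / b - 1) a :=
    (continuousAt_const.div continuousAt_id ha).sub continuousAt_const
  have h2 : a / a - 1 = 0 := by rw [div_self ha, sub_self]
  simpa [h2] using h1.tendsto

/-- As `b ↑ a` (`a > 0`) the parameter `a/b − 1 ↓ 0`. [folklore] -/
theorem tendsto_window_param_left {a : ℝ} (ha : 0 < a) :
    Tendsto (fun b : ℝ ↦ a / b - 1) (𝓝[<] a) (𝓝[>] 0) := by
  refine tendsto_nhdsWithin_iff.2 ⟨(tendsto_window_param ha.ne').mono_left nhdsWithin_le_nhds, ?_⟩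
  have hpos : ∀ᶠ b : ℝ in 𝓝[<] a, 0 < b := (lt_mem_nhds ha).filter_mono nhdsWithin_le_nhds
  filter_upwards [hpos, self_mem_nhdsWithin] with b hb hba
  rw [mem_Ioi, sub_pos, one_lt_div hb]
  exact hba

/-- As `b ↓ a` (`a > 0`) the parameter `a/b − 1 ↑ 0`. [folklore] -/
theorem tendsto_window_param_right {a : ℝ} (ha : 0 < a) :
    Tendsto (fun b : ℝ ↦ a / b - 1) (𝓝[>] a) (𝓝[<] 0) := by
  refine tendsto_nhdsWithin_iff.2 ⟨(tendsto_window_param ha.ne').mono_left nhdsWithin_le_nhds, ?_⟩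
  filter_upwards [self_mem_nhdsWithin] with b hab
  have hb : 0 < b := ha.trans hab
  rw [mem_Iio, sub_neg, div_lt_one hb]
  exact hab

namespace WindowForm

variable {W : WindowForm}

/-! ## §2 The Dini edge law over the interface `WindowForm` -/

/-- **DINI EDGE LAW, LEFT WINDOWS (compression side).** For a windowed form `W`, a
dilation-covariant window `a > 0`, a ground state `u` of `a` whose profile has RIGHT derivative
`V` at `η = 0`, and every slope `s < −V/a`: for all windows `b < a` close to `a`,
`s < (ε(b) − ε(a))/(b − a)` — i.e. `D₋ε(a) ≥ −V/a`.  No differentiability of `ε`. [cite: Kato1966, II §6.4 and VII §6.5 (one-sided derivatives of eigenvalues; forms with varying domain)] -/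
theorem lt_slope_energy_eventually_left {a : ℝ} {u : ℝ → ℂ} (ha : 0 < a)
    (hcov : W.DilationCovariantAt a) (hu : W.IsGround a u) {V : ℝ}
    (hV : HasDerivWithinAt (W.profile u) V (Ioi 0) 0) {s : ℝ} (hs : s < -V / a) :
    ∀ᶠ b in 𝓝[<] a, s < slope W.energy a b := by
  have hp : Tendsto (slope (W.profile u) 0) (𝓝[>] 0) (𝓝 V) :=
    (hasDerivWithinAt_iff_tendsto_slope' (by simp : (0 : ℝ) ∉ Ioi 0)).1 hV
  have h1 : Tendsto (fun b : ℝ ↦ slope (W.profile u) 0 (a / b - 1)) (𝓝[<] a) (𝓝 V) :=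
    hp.comp (tendsto_window_param_left ha)
  have hb : Tendsto (fun b : ℝ ↦ b) (𝓝[<] a) (𝓝 a) := tendsto_id.mono_left nhdsWithin_le_nhds
  have h2 : Tendsto (fun b : ℝ ↦ -b * s - slope (W.profile u) 0 (a / b - 1)) (𝓝[<] a)
      (𝓝 (-a * s - V)) := (hb.neg.mul_const s).sub h1
  have h3 : 0 < -a * s - V := by
    have := (lt_div_iff₀ ha).1 hs
    linarith
  have h4 : ∀ᶠ b : ℝ in 𝓝[<] a, 0 < -b * s - slope (W.profile u) 0 (a / b - 1) :=
    h2.eventually (lt_mem_nhds h3)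
  have h5 : ∀ᶠ b : ℝ in 𝓝[<] a, a / 2 < b :=
    (lt_mem_nhds (by linarith : a / 2 < a)).filter_mono nhdsWithin_le_nhds
  filter_upwards [h4, h5, self_mem_nhdsWithin] with b hb4 hb5 hba
  rw [mem_Iio] at hba
  have hb0 : 0 < b := by linarith
  set η : ℝ := a / b - 1 with hη_def
  have hη0 : 0 < η := by
    rw [hη_def, sub_pos, one_lt_div hb0]
    exact hba
  have hη1 : η ≤ 1 := by
    rw [hη_def, sub_le_iff_le_add, div_le_iff₀ hb0]
    linarith
  have h7 : 1 + η = a / b := by rw [hη_def]; ring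
  have hwin : a / (1 + η) = b := by
    rw [h7, div_div_eq_mul_div, mul_div_cancel_left₀ b ha.ne']
  have htouch : W.energy b ≤ W.profile u η := by
    have h := energy_div_le_profile hcov hu (by linarith : -(1 / 2 : ℝ) ≤ η) hη1
    rwa [hwin] at h
  have h0 : W.profile u 0 = W.energy a := profile_zero hu
  have h6 : slope (W.profile u) 0 η < -b * s := by linarith
  rw [slope_def_field, sub_zero, div_lt_iff₀ hη0, h0] at h6
  have hbη : b * η = a - b := by
    rw [hη_def, mul_sub, mul_div_cancel₀ a hb0.ne', mul_one]
  have h8 : -b * s * η = s * (b - a) := by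
    have : -b * s * η = -(s * (b * η)) := by ring
    rw [this, hbη]
    ring
  rw [slope_def_field, lt_div_iff_of_neg (by linarith : b - a < 0)]
  linarith [htouch, h6, h8]

/-- **DINI EDGE LAW, RIGHT WINDOWS (expansion side).** For a windowed form `W`, a
dilation-covariant window `a > 0`, a ground state `u` of `a` whose profile has LEFT derivative `V`
at `η = 0`, and every slope `s > −V/a`: for all windows `b > a` close to `a`,
`(ε(b) − ε(a))/(b − a) < s` — i.e. `D⁺ε(a) ≤ −V/a`.  No differentiability of `ε`. [cite: Kato1966, II §6.4 and VII §6.5 (one-sided derivatives of eigenvalues; forms with varying domain)] -/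
theorem slope_energy_lt_eventually_right {a : ℝ} {u : ℝ → ℂ} (ha : 0 < a)
    (hcov : W.DilationCovariantAt a) (hu : W.IsGround a u) {V : ℝ}
    (hV : HasDerivWithinAt (W.profile u) V (Iio 0) 0) {s : ℝ} (hs : -V / a < s) :
    ∀ᶠ b in 𝓝[>] a, slope W.energy a b < s := by
  have hp : Tendsto (slope (W.profile u) 0) (𝓝[<] 0) (𝓝 V) :=
    (hasDerivWithinAt_iff_tendsto_slope' (by simp : (0 : ℝ) ∉ Iio 0)).1 hV
  have h1 : Tendsto (fun b : ℝ ↦ slope (W.profile u) 0 (a / b - 1)) (𝓝[>] a) (𝓝 V) :=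
    hp.comp (tendsto_window_param_right ha)
  have hb : Tendsto (fun b : ℝ ↦ b) (𝓝[>] a) (𝓝 a) := tendsto_id.mono_left nhdsWithin_le_nhds
  have h2 : Tendsto (fun b : ℝ ↦ slope (W.profile u) 0 (a / b - 1) - -b * s) (𝓝[>] a)
      (𝓝 (V - -a * s)) := h1.sub (hb.neg.mul_const s)
  have h3 : 0 < V - -a * s := by
    have := (div_lt_iff₀ ha).1 hs
    linarith
  have h4 : ∀ᶠ b : ℝ in 𝓝[>] a, 0 < slope (W.profile u) 0 (a / b - 1) - -b * s :=
    h2.eventually (lt_mem_nhds h3)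
  have h5 : ∀ᶠ b : ℝ in 𝓝[>] a, b < 2 * a :=
    (gt_mem_nhds (by linarith : a < 2 * a)).filter_mono nhdsWithin_le_nhds
  filter_upwards [h4, h5, self_mem_nhdsWithin] with b hb4 hb5 hab
  rw [mem_Ioi] at hab
  have hb0 : 0 < b := ha.trans hab
  set η : ℝ := a / b - 1 with hη_def
  have hη0 : η < 0 := by
    rw [hη_def, sub_neg, div_lt_one hb0]
    exact hab
  have hη1 : -(1 / 2 : ℝ) ≤ η := by
    rw [hη_def, le_sub_iff_add_le, le_div_iff₀ hb0]
    linarith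
  have h7 : 1 + η = a / b := by rw [hη_def]; ring
  have hwin : a / (1 + η) = b := by
    rw [h7, div_div_eq_mul_div, mul_div_cancel_left₀ b ha.ne']
  have htouch : W.energy b ≤ W.profile u η := by
    have h := energy_div_le_profile hcov hu hη1 (by linarith : η ≤ 1)
    rwa [hwin] at h
  have h0 : W.profile u 0 = W.energy a := profile_zero hu
  have h6 : -b * s < slope (W.profile u) 0 η := by linarith
  rw [slope_def_field, sub_zero, lt_div_iff_of_neg hη0, h0] at h6
  have hbη : b * η = a - b := by
    rw [hη_def, mul_sub, mul_div_cancel₀ a hb0.ne', mul_one]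
  have h8 : -b * s * η = s * (b - a) := by
    have : -b * s * η = -(s * (b * η)) := by ring
    rw [this, hbη]
    ring
  rw [slope_def_field, div_lt_iff₀ (by linarith : (0 : ℝ) < b - a)]
  linarith [htouch, h6, h8]

/-- With a LEFT derivative `e` of the bottom at `a` and a right profile derivative `V₊` of a
ground state: `−V₊/a ≤ e`. [cite: Kato1966, II §6.4 (one-sided derivatives at a crossing)] -/
theorem neg_div_le_of_hasDerivWithinAt_energy_Iio {a : ℝ} {u : ℝ → ℂ} (ha : 0 < a)
    (hcov : W.DilationCovariantAt a) (hu : W.IsGround a u) {V e : ℝ}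
    (hV : HasDerivWithinAt (W.profile u) V (Ioi 0) 0)
    (he : HasDerivWithinAt W.energy e (Iio a) a) : -V / a ≤ e := by
  have ht : Tendsto (slope W.energy a) (𝓝[<] a) (𝓝 e) :=
    (hasDerivWithinAt_iff_tendsto_slope' (show a ∉ Iio a from lt_irrefl a)).1 he
  refine le_of_forall_lt_imp_le_of_dense fun s hs ↦ ?_
  exact ge_of_tendsto ht
    ((lt_slope_energy_eventually_left ha hcov hu hV hs).mono fun _ h ↦ h.le)

/-- With a RIGHT derivative `e` of the bottom at `a` and a left profile derivative `V₋` of a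
ground state: `e ≤ −V₋/a`. [cite: Kato1966, II §6.4 (one-sided derivatives at a crossing)] -/
theorem le_neg_div_of_hasDerivWithinAt_energy_Ioi {a : ℝ} {u : ℝ → ℂ} (ha : 0 < a)
    (hcov : W.DilationCovariantAt a) (hu : W.IsGround a u) {V e : ℝ}
    (hV : HasDerivWithinAt (W.profile u) V (Iio 0) 0)
    (he : HasDerivWithinAt W.energy e (Ioi a) a) : e ≤ -V / a := by
  have ht : Tendsto (slope W.energy a) (𝓝[>] a) (𝓝 e) :=
    (hasDerivWithinAt_iff_tendsto_slope' (show a ∉ Ioi a from lt_irrefl a)).1 he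
  refine le_of_forall_gt_imp_ge_of_dense fun s hs ↦ ?_
  exact le_of_tendsto ht
    ((slope_energy_lt_eventually_right ha hcov hu hV hs).mono fun _ h ↦ h.le)

/-- **THE DINI EDGE LAW (two-sided profile derivative).** For a ground state `u` of a
dilation-covariant window `a > 0` whose profile is differentiable at `0` with derivative `V`:
`D⁺ε(a) ≤ −V/a ≤ D₋ε(a)` — every right slope of the bottom near `a` lies below, every left slope
above, `−V/a` (up to any margin).  When `ε` is differentiable at `a` this is the edge law
`a·ε'(a) = −V`; otherwise `ε` has a concave corner at `a`. [cite: Kato1966, II §6.4 and VII §6.5] -/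
theorem dini_edge_law {a : ℝ} {u : ℝ → ℂ} (ha : 0 < a) (hcov : W.DilationCovariantAt a)
    (hu : W.IsGround a u) {V : ℝ} (hV : HasDerivAt (W.profile u) V 0) :
    (∀ s : ℝ, s < -V / a → ∀ᶠ b in 𝓝[<] a, s < slope W.energy a b) ∧
      (∀ s : ℝ, -V / a < s → ∀ᶠ b in 𝓝[>] a, slope W.energy a b < s) :=
  ⟨fun _ hs ↦ lt_slope_energy_eventually_left ha hcov hu hV.hasDerivWithinAt hs,
    fun _ hs ↦ slope_energy_lt_eventually_right ha hcov hu hV.hasDerivWithinAt hs⟩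

/-- **Corner at a mode switch.** Two ground states of one dilation-covariant window whose
profiles are differentiable at `0` with DIFFERENT virials force non-differentiability of the bottom
there (contrapositive of `profile_deriv_unique`; by `dini_edge_law` the corner is concave: right
slopes `≤ −max(V,V')/a < −min(V,V')/a ≤` left slopes). [cite: Kato1966, II §6.4] -/
theorem not_differentiableAt_energy_of_ne {a : ℝ} {u v : ℝ → ℂ} (hcov : W.DilationCovariantAt a)
    (hu : W.IsGround a u) (hv : W.IsGround a v) {V V' : ℝ} (hV : HasDerivAt (W.profile u) V 0)
    (hV' : HasDerivAt (W.profile v) V' 0) (hne : V ≠ V') : ¬ DifferentiableAt ℝ W.energy a :=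
  fun hd ↦ hne (profile_deriv_unique hcov hu hv hd hV hV')

end WindowForm

/-! ## §3 ζ instances -/

/-- ζ, left windows: a Weil ground state `u` of the window `a` whose dilation profile has right
derivative `V₊` at `0` gives `D₋ weilGroundEnergy (a) ≥ −V₊/a`. [cite: Kato1966, II §6.4 and VII §6.5] -/
theorem lt_slope_weilGroundEnergy_eventually {a : ℝ} {u : ℝ → ℂ} (hu : IsWeilGroundState a u)
    {V : ℝ} (hV : HasDerivWithinAt (weilDilationProfile a u) V (Ioi 0) 0) {s : ℝ}
    (hs : s < -V / a) : ∀ᶠ b in 𝓝[<] a, s < slope weilGroundEnergy a b :=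
  WindowForm.lt_slope_energy_eventually_left (W := weilWindowForm a) hu.pos
    (weilWindowForm_dilationCovariantAt le_rfl) (isGround_weilWindowForm hu le_rfl)
    (by rwa [weilWindowForm_profile]) hs

/-- ζ, right windows: a Weil ground state `u` of the window `a` whose dilation profile has left
derivative `V₋` at `0` gives `D⁺ weilGroundEnergy (a) ≤ −V₋/a`. [cite: Kato1966, II §6.4 and VII §6.5] -/
theorem slope_weilGroundEnergy_lt_eventually {a : ℝ} {u : ℝ → ℂ} (hu : IsWeilGroundState a u)
    {V : ℝ} (hV : HasDerivWithinAt (weilDilationProfile a u) V (Iio 0) 0) {s : ℝ}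
    (hs : -V / a < s) : ∀ᶠ b in 𝓝[>] a, slope weilGroundEnergy a b < s :=
  WindowForm.slope_energy_lt_eventually_right (W := weilWindowForm a) hu.pos
    (weilWindowForm_dilationCovariantAt le_rfl) (isGround_weilWindowForm hu le_rfl)
    (by rwa [weilWindowForm_profile]) hs

/-- **ζ: the Dini edge law at EVERY window carrying a ground state with differentiable profile**
(no hypothesis on `weilGroundEnergy`): `D⁺ε(a) ≤ −V/a ≤ D₋ε(a)`. [cite: Kato1966, II §6.4 and VII §6.5] -/
theorem dini_edge_law_weilGroundEnergy {a : ℝ} {u : ℝ → ℂ} (hu : IsWeilGroundState a u) {V : ℝ}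
    (hV : HasDerivAt (weilDilationProfile a u) V 0) :
    (∀ s : ℝ, s < -V / a → ∀ᶠ b in 𝓝[<] a, s < slope weilGroundEnergy a b) ∧
      (∀ s : ℝ, -V / a < s → ∀ᶠ b in 𝓝[>] a, slope weilGroundEnergy a b < s) :=
  ⟨fun _ hs ↦ lt_slope_weilGroundEnergy_eventually hu hV.hasDerivWithinAt hs,
    fun _ hs ↦ slope_weilGroundEnergy_lt_eventually hu hV.hasDerivWithinAt hs⟩

/-- **ζ, UNCONDITIONAL AT EVERY SMALL WINDOW `0 < a < ½ log 2`**: for EVERY Weil ground state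
`u` of the window `a`, with `V = weilSmallWindowVirial a u` (the profile IS differentiable there,
`hasDerivAt_weilDilationProfile_of_lt`): `D⁺ weilGroundEnergy (a) ≤ −V/a ≤ D₋ weilGroundEnergy (a)`.
At a differentiability window this is `a·ε'(a) = −V`; at any other small window the bottom has a
concave corner whose one-sided slopes bracket `−V(u)/a` for every ground state `u`. [folklore] -/
theorem dini_edge_law_weilGroundEnergy_of_lt {a : ℝ} {u : ℝ → ℂ} (hu : IsWeilGroundState a u)
    (ha2 : a < Real.log 2 / 2) :
    (∀ s : ℝ, s < -weilSmallWindowVirial a u / a →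
        ∀ᶠ b in 𝓝[<] a, s < slope weilGroundEnergy a b) ∧
      (∀ s : ℝ, -weilSmallWindowVirial a u / a < s →
        ∀ᶠ b in 𝓝[>] a, slope weilGroundEnergy a b < s) :=
  dini_edge_law_weilGroundEnergy hu (hasDerivAt_weilDilationProfile_of_lt hu ha2)

/-- **Corner at a small-window mode switch (ζ).** Two Weil ground states of one window
`0 < a < ½ log 2` with different small-window virials force a corner of `weilGroundEnergy` at `a`.
[folklore] -/
theorem not_differentiableAt_weilGroundEnergy_of_ne {a : ℝ} {u v : ℝ → ℂ}
    (hu : IsWeilGroundState a u) (hv : IsWeilGroundState a v) (ha2 : a < Real.log 2 / 2)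
    (hne : weilSmallWindowVirial a u ≠ weilSmallWindowVirial a v) :
    ¬ DifferentiableAt ℝ weilGroundEnergy a :=
  WindowForm.not_differentiableAt_energy_of_ne (W := weilWindowForm a)
    (weilWindowForm_dilationCovariantAt le_rfl) (isGround_weilWindowForm hu le_rfl)
    (isGround_weilWindowForm hv le_rfl)
    (by rw [weilWindowForm_profile]; exact hasDerivAt_weilDilationProfile_of_lt hu ha2)
    (by rw [weilWindowForm_profile]; exact hasDerivAt_weilDilationProfile_of_lt hv ha2) hne

end Summit.RiemannHypothesis.RiemannHypothesis.Theorems.PfPersistence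

end
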